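import Summits.HodgeConjecture.HodgeConjecture.Theses.KugaSatakeSaturation
import Literature.AlgebraicGeometry.Motives.KugaSatakeFullEmbedding

/-!
# Route `KugaSatakeSaturation` — support item `KSWellDefined` (stmt-HodgeConjecture-9374)

Both sanity / non-vacuity items of the route (this one and `KSEmbeddingHodge`, stmt-HodgeConjecture-9375,
closed in the sibling file `KugaSatakeSaturationKSEmbeddingHodge.lean`) are, up to unfolding, theorems of
the Literature file
`Motives/KugaSatakeFull` / `Motives/KugaSatakeFullEmbedding` (the full-Clifford Kuga–Satake Hodge
structure, vG §5–6 / Huybrechts Ch. 4 §2): `kugaSatakeFullF1 H P` is BY `rfl` the route's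
`F¹_KS = Submodule.map ((CliffordAlgebra.ι Q_P).baseChange ℂ) (H.piece 2 0) * ⊤`
(`kugaSatakeFullF1_eq`), `P.quadraticForm = LinearMap.BilinMap.toQuadraticMap P.form`, and the route's
embedding `μ₀ = (LinearMap.mul ℚ C).comp (CliffordAlgebra.ι Q_P)` is `KugaSatake.leftEmbedding`.

* `KSWellDefined` = `kugaSatakeFull_wellDefined`: `C(Q)_ℂ = F¹_KS ⊕ conj F¹_KS` and
  `2 dim_ℂ F¹_KS = dim_ℚ C(Q)` (`ω² = Q(ω) = 0`, `ωω̄ + ω̄ω = 2P(ω, ω̄) ≠ 0`, `dim C(q) = 2^{dim V}`);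
* `KSEmbeddingHodge` = `kugaSatakeFull_leftEmbedding_hodge`: `L_{ι θ}` preserves `F¹_KS` for
  `θ ∈ F¹V_ℂ`, and for `θ ∈ V^{2,0}` maps `C(Q)_ℂ` into `F¹_KS` and `F¹_KS` to `0`.

The route's extra hypothesis `H.F 3 = ⊥` is not needed.  No definition, no named-fact hypothesis,
no sorry.
-/

set_option linter.dupNamespace false

noncomputable section

namespace Summit.HodgeConjecture.HodgeConjecture.Theorems

open Literature.AlgebraicGeometry.Motives Literature.AlgebraicGeometry.Motives.HodgeStructure

/-- **Item stmt-HodgeConjecture-9374 (`KSWellDefined`, route `KugaSatakeSaturation`)**: for a polarized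
weight-two `(T, H, P)` with `h^{2,0} = 1`, `F¹_KS := ι_ℂ(T^{2,0})·C_ℂ` and its complex conjugate are
complementary in `ℂ ⊗ C(T, Q_P)` and `2 · dim_ℂ F¹_KS = dim_ℚ C` — the Literature theorem
`kugaSatakeFull_wellDefined` (vG 5.5–5.7; Huybrechts Ch. 4 §2.1), verbatim up to `rfl`-unfolding of
`kugaSatakeFullF1`.  The type is literally the route decl
`Summit.HodgeConjecture.HodgeConjecture.Theses.KugaSatakeSaturation.KSWellDefined`.
[cite: vanGeemen2000KugaSatakeHC, 5.5–5.7] [cite: Huybrechts2016K3, Ch. 4 §2.1] -/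
theorem kugaSatakeSaturation_ksWellDefined_proof :
    Summit.HodgeConjecture.HodgeConjecture.Theses.KugaSatakeSaturation.KSWellDefined := by
  intro T _ _ _ H P _ h20
  exact kugaSatakeFull_wellDefined H P h20

end Summit.HodgeConjecture.HodgeConjecture.Theorems

end
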